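import Summits.AnomalousDissipation.AnomalousDissipation.Theorems.BaireTransferDenseLoudDesignerForcesErgodicLine
import Literature.Analysis.UnboundedOperators.DiagonalSemigroupCalculus

/-!
# Analytic-semigroup calculus of the diagonal Stokes frame on `H` (line `ergodic-budget-selection-closing`,
# crux `BaireTransfer.DenseLoudDesignerForces`, stmt-AnomalousDissipation-1143) — tools stub S1b of block N-R

Sorry-free file over the landed vocabulary `…ErgodicLine.lean` (`Hsp = Torus.energySpace (Fin 3)`) and the landed
Literature calculus `Literature/Analysis/UnboundedOperators/DiagonalSemigroupCalculus.lean`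
(`exists_diagonalSemigroupCalculus`: for ANY Hilbert basis `b` of a real Hilbert space, symbol `m ≥ 0` and families
`T`, `K` acting on the basis as `e^{-tm}`, `m^{3/4} e^{-tm}`, the families `K₁ = A T = diag(m e^{-tm})`,
`K₂ = A K = diag(m^{7/4} e^{-tm})`, their norm bounds, the OPERATOR-NORM derivatives `T' = -K₁`, `K' = -K₂` on
`(0, ∞)`, norm-continuity and the domain identity `K₁ t = A ∘ T t`).  Block N-R of the line builds the smooth model
of the Navier–Stokes semiflow from the mild (Duhamel) formulation; its time-regularity brick S4b (joint `C²` of the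
mild flow in `(t, y)`) consumes exactly this calculus of the Stokes frame of S1 (`stub_stokesSemigroupFrameTools`):

* `stub_diagonalSemigroupCalculusTools` (the REGISTERED tools stub, proved) — the case `H = Hsp`, `0 < m i` of
  `exists_diagonalSemigroupCalculus`.

References: D. Henry, *Geometric Theory of Semilinear Parabolic Equations* (1981), Thm. 1.3.4 (analytic
semigroups: `d/dt e^{-tA} = -A e^{-tA}` in norm, `‖A e^{-tA}‖ ≤ C/t`) and Thm. 1.4.3 (`‖A^α e^{-tA}‖ ≤ C_α t^{-α}`);
A. Pazy, *Semigroups of Linear Operators* (1983), Thm. 2.6.13.  Nothing is asserted; no definition is added.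
-/

-- `Summit.<Summit>.<Problem>` is the tree's mandated summit-side namespace (CONVENTIONS §2); for this
-- single-conjunct summit the two coincide, so the duplicate is deliberate.
set_option linter.dupNamespace false

noncomputable section

open Set Function MeasureTheory Filter
open scoped InnerProductSpace

namespace Summit.AnomalousDissipation.AnomalousDissipation.Theorems.DenseLoudDesignerForces.Ergodic

open Literature.Analysis.FunctionSpaces Literature.Analysis.FunctionSpaces.Torus
open Literature.Analysis.FluidPDE Literature.Analysis.FluidPDE.Torus

/-- **Tools stub S1b — analytic-semigroup calculus of the diagonal frame (block N-R; input of the time-regularity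
brick S4b).**  For the diagonal semigroup `T t = diag(e^{-tm})` (`t ≥ 0`) and smoothing family
`K t = diag(m^{3/4} e^{-tm})` (`t > 0`) on a Hilbert basis `b` of `Hsp` with positive symbol `m` (given as ANY
families of bounded operators acting like this on the basis, e.g. the Stokes frame of `stub_stokesSemigroupFrameTools`),
there are families `K₁ = A T = diag(m e^{-tm})` and `K₂ = A K = diag(m^{7/4} e^{-tm})` (`t > 0`), bounded by
`‖K₁ t‖ ≤ t⁻¹` and `‖K₂ t‖ ≤ 2 t^{-7/4}` (`x^β e^{-x} ≤ β^β e^{-β}`), such that `T` and `K` are differentiable on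
`(0, ∞)` IN OPERATOR NORM with `T' = -K₁`, `K' = -K₂` (uniform second-order Taylor bound on the symbols), `T, K, K₁,
K₂` are norm-continuous on `(0, ∞)`, and `T t y ∈ D(A)` with `A (T t y) = K₁ t y` for `A = b.diagonalPMap m`, all
`y ∈ Hsp`, `t > 0` (Henry 1981, Thm. 1.3.4 and Thm. 1.4.3: `-A` generates an analytic semigroup,
`d/dt e^{-tA} = -A e^{-tA}`, `‖A^α e^{-tA}‖ ≤ C_α t^{-α}`; the tree's `exists_diagonalSemigroupCalculus` at `H = Hsp`).
[cite: Henry1981, Thm. 1.3.4 and Thm. 1.4.3] -/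
theorem stub_diagonalSemigroupCalculusTools (ι : Type) (b : HilbertBasis ι ℝ Hsp) (m : ι → ℝ) (hpos : ∀ i, 0 < m i)
    (T K : ℝ → Hsp →L[ℝ] Hsp) (hT : ∀ t i, 0 ≤ t → T t (b i) = Real.exp (-(t * m i)) • b i)
    (hK : ∀ t i, 0 < t → K t (b i) = ((m i) ^ (3 / 4 : ℝ) * Real.exp (-(t * m i))) • b i) :
    ∃ K₁ K₂ : ℝ → Hsp →L[ℝ] Hsp,
      (∀ t i, 0 < t → K₁ t (b i) = (m i * Real.exp (-(t * m i))) • b i) ∧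
      (∀ t i, 0 < t → K₂ t (b i) = ((m i) ^ (7 / 4 : ℝ) * Real.exp (-(t * m i))) • b i) ∧
      (∀ t, 0 < t → ‖K₁ t‖ ≤ t⁻¹) ∧ (∀ t, 0 < t → ‖K₂ t‖ ≤ 2 * t ^ (-(7 / 4 : ℝ))) ∧
      (∀ t, 0 < t → HasDerivAt T (-(K₁ t)) t) ∧ (∀ t, 0 < t → HasDerivAt K (-(K₂ t)) t) ∧
      ContinuousOn T (Ioi 0) ∧ ContinuousOn K (Ioi 0) ∧ ContinuousOn K₁ (Ioi 0) ∧ ContinuousOn K₂ (Ioi 0) ∧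
      (∀ t, 0 < t → ∀ y : Hsp, ∃ hy : T t y ∈ (b.diagonalPMap m).domain, b.diagonalPMap m ⟨T t y, hy⟩ = K₁ t y) :=
  Literature.Analysis.UnboundedOperators.exists_diagonalSemigroupCalculus b m (fun i => (hpos i).le) T K
    (fun t i ht => hT t i ht.le) hK

end Summit.AnomalousDissipation.AnomalousDissipation.Theorems.DenseLoudDesignerForces.Ergodic
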